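import Summits.BirchSwinnertonDyer.BirchSwinnertonDyer.Theorems.ThetaPartnerAtTwoSignedControlAtTwoShaThreeBaseImaginary
import Literature.NumberTheory.GaloisRepresentations.CorestrictionTransitive
import Literature.NumberTheory.GaloisRepresentations.BrauerTower
import HarnessLib

/-!
# K4 `SignedControlAtTwo`, base case of Milne I Thm. 4.10 (c)₃: corestrictions from `Γ_{F(√a)}` (`a` totally negative)
# are corestrictions from `Γ_{F(√-1)}` (brick B7 of the `hbase` road)

Route `ThetaPartnerAtTwo` (TP2), crux K4 `SignedControlAtTwo` (stmt-BirchSwinnertonDyer-20309), line `eulerchar` v15, stub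
`stub_realThreeOrderTwoBase` (the lead's binder `hbase`); extra width seat `bsd-wall-tp2-p3-w4` gen 0
(`--supports stmt-BirchSwinnertonDyer-20309`, helper).  Brick **B7** of the road `Cruxes/SignedControlAtTwo/HBASE-ROAD-w2g7.md`:
the sibling files reduce `hbase(F, T)` to the norm statement (NORM_T) «every real-trivial class of `H²(Γ_F, T)` lies in
`cor(H²(Γ_{F(√-1)}, T))`» (`…ShaThreeBaseImaginary.realThree_injective_of_norm_imaginary`), and produce such a class as a
corestriction from `S' = Γ_{F(√-e)}` with `e` totally POSITIVE (`…ShaThreeBaseKilling`, `…ShaThreeBaseGysinTwo`, quadratic Kummer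
transfer).  This file is the last transport step `S' → S_I = Γ_{F(√-1)}`:

* §1 (profinite `G`, discrete `G`-module `M`): `ofSubgroupOf_surjective` (the tautological comparison
  `H^q(S'.subgroupOf S, M) → H^q(S', M)` of `CorestrictionTransitive.lean` is onto) and **`range_cor_subset_range_cor_of_le`** —
  for closed subgroups `S'' ≤ S₁` of finite index, `cor_{S''}(H^q(S'', M)) ⊆ cor_{S₁}(H^q(S₁, M))` (the tree's transitivity
  `cor_cor_subgroupOf`, in range form).
* §2 (moreover `M = T` with TRIVIAL action and `2T = 0`): **`range_cor_two_subset_of_index_two`** — for `S'` closed of finite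
  index with `H³(S', T) = 0` and `S₁` closed of index `2`, `cor_{S'}(H²(S', T)) ⊆ cor_{S₁}(H²(S₁, T))`: `S₁` is normal, so
  `[S' : S' ∩ S₁] ∈ {1, 2}`; in the second case the corestriction `H²(S' ∩ S₁, T) → H²(S', T)` is onto by the siblings' (α3)
  `mem_range_cor_two_of_subsingleton_three` run on the profinite group `↥S'` (short exact sequence
  `isSES_unitCoind_normCoind` of the index-`2` induced module), and transitivity is applied twice.
* §3 (number field `F`, trivial `Γ_F`-module `T` with `2T = 0`): **`range_cor_galFixing_adjoin_subset_of_neg`** — for `a ∈ F`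
  negative at every real embedding, `α² = a`, `α ∉ F`, and `I² = -1`, `I ∉ F`:
  `cor(H²(Γ_{F(α)}, T)) ⊆ cor(H²(Γ_{F(I)}, T))` inside `H²(Γ_F, T)` (`cd₂(Γ_{F(α)}) ≤ 2` by the sibling's
  `groupCdLE_two_galFixing_adjoin`, `[Γ_F : Γ_{F(I)}] = 2` by `index_galFixing_adjoin_eq_two`).

HONEST FRAMING: THEOREMS ONLY (no definition, no named fact, no `sorry`); closes no item by itself; BSD is not proved by any of this.
References: [SerreGaloisCohomology1997] I §2.5 (corestriction, transitivity), II §4.4 Prop. 13; [NeukirchSchmidtWingberg2008] I §5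
Prop. (1.5.3) (iii); [MilneADT2006] I Thm. 4.10 (c).
-/

set_option autoImplicit false
-- the Theorems namespace of this sub repeats the summit name by design (D-0017 nested layout)
set_option linter.dupNamespace false

noncomputable section

open CategoryTheory Function NumberField Field
open _root_.TopRep _root_.ContRepresentation _root_.ContinuousCohomology
open Literature.NumberTheory.GaloisRepresentations
open Literature.NumberTheory.GaloisRepresentations.LocalWeilDatum

universe u

namespace Summit.BirchSwinnertonDyer.BirchSwinnertonDyer.Theorems.SignedEC.ShaThreeBase

/-! ## §1 Transitivity of the corestriction in range form -/

section RangeTrans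

variable {G : Type u} [Group G] [TopologicalSpace G] [IsTopologicalGroup G] [CompactSpace G]
  [T2Space G] [TotallyDisconnectedSpace G]
variable {M : Type u} [AddCommGroup M] [TopologicalSpace M] [DiscreteTopology M]
variable (ρ : ContinuousRep G ℤ M)

omit [CompactSpace G] [T2Space G] [TotallyDisconnectedSpace G] in
/-- **The tautological comparison `H^q(S'.subgroupOf S, M) → H^q(S', M)` is onto**: it is induced by the continuous
isomorphism `S' ≅ S'.subgroupOf S` and the identity of `M`, so the comparison along the inverse isomorphism is a
right inverse (`map_comp_apply_of`, `map_id_eq_id`). [cite: SerreGaloisCohomology1997, I §2.5] -/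
theorem ofSubgroupOf_surjective (S S' : Subgroup G) (h : S' ≤ S) (q : ℕ) :
    Function.Surjective (ofSubgroupOf S S' ρ h q) := by
  intro z
  -- the inverse comparison, along `S'.subgroupOf S → S'`
  let ψ : (S'.subgroupOf S : Subgroup S) →ₜ* S' :=
    (Subgroup.subgroupOfContinuousMulEquivOfLe h : (S'.subgroupOf S : Subgroup S) →ₜ* S')
  let g : TopRep.res (ψ : (S'.subgroupOf S : Subgroup S) →* S') (ρ.restrict (subgroupIncl S')).toTopRep ⟶
      (repSub S S' ρ).toTopRep :=
    TopRep.ofHom ⟨ContinuousLinearMap.id ℤ M, fun _ => rfl⟩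
  let f₀ : TopRep.res (toSubgroupOfHom S S' h : S' →* (S'.subgroupOf S : Subgroup S)) (repSub S S' ρ).toTopRep ⟶
      (ρ.restrict (subgroupIncl S')).toTopRep :=
    TopRep.ofHom ⟨ContinuousLinearMap.id ℤ M, fun _ => rfl⟩
  let i₀ : TopRep.res ((ContinuousMonoidHom.id S' : S' →ₜ* S') : S' →* S') (ρ.restrict (subgroupIncl S')).toTopRep ⟶
      (ρ.restrict (subgroupIncl S')).toTopRep :=
    TopRep.ofHom ⟨ContinuousLinearMap.id ℤ M, fun _ => rfl⟩
  refine ⟨ContinuousCohomology.map ψ g q z, ?_⟩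
  have hcomp := map_comp_apply_of ψ (toSubgroupOfHom S S' h) (ContinuousMonoidHom.id S') (fun _ => rfl)
    g f₀ i₀ (fun _ => rfl) q z
  rw [map_id_eq_id i₀ (fun _ => rfl) q] at hcomp
  exact hcomp.symm

/-- **Transitivity of the corestriction, range form**: for closed subgroups `S'' ≤ S₁` of finite index of a profinite
group `G` and a discrete `G`-module `M`, `cor_{S''}(H^q(S'', M)) ⊆ cor_{S₁}(H^q(S₁, M))` in `H^q(G, M)`
(`cor_{G/S''} = cor_{G/S₁} ∘ cor_{S₁/S''}`, the tree's `cor_cor_subgroupOf`).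
[cite: SerreGaloisCohomology1997, I §2.5] [cite: NeukirchSchmidtWingberg2008, I §5 Prop. 1.5.3 (iii)] -/
theorem range_cor_subset_range_cor_of_le {S'' S₁ : Subgroup G} [hS'' : IsClosed (S'' : Set G)]
    [hS₁ : IsClosed (S₁ : Set G)] [Fintype (G ⧸ S'')] [Fintype (G ⧸ S₁)] (h : S'' ≤ S₁) (q : ℕ) :
    Set.range (cor S'' ρ q) ⊆ Set.range (cor S₁ ρ q) := by
  classical
  -- `S''.subgroupOf S₁` has finite index in `S₁`
  have hrel : S''.relIndex S₁ ≠ 0 := fun h0 =>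
    Subgroup.index_ne_zero_of_finite (H := S'') (by rw [← Subgroup.relIndex_mul_index h, h0, zero_mul])
  haveI : Fintype (S₁ ⧸ S''.subgroupOf S₁) := Subgroup.fintypeOfIndexNeZero hrel
  haveI : CompactSpace S₁ := compactSpace_of_isClosed_subgroup
  haveI : IsClosed ((S''.subgroupOf S₁ : Subgroup S₁) : Set S₁) := isClosed_subgroupOf_of_isClosed S₁ S''
  rintro _ ⟨z, rfl⟩
  obtain ⟨z₀, rfl⟩ := ofSubgroupOf_surjective ρ S₁ S'' h q z
  exact ⟨_, cor_cor_subgroupOf S₁ S'' ρ h q z₀⟩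

end RangeTrans

/-! ## §2 From `S'` with `H³(S', T) = 0` to an index-`2` subgroup `S₁` -/

section IndexTwoTransfer

variable {G : Type u} [Group G] [TopologicalSpace G] [IsTopologicalGroup G] [CompactSpace G]
  [T2Space G] [TotallyDisconnectedSpace G]
variable {T : Type u} [AddCommGroup T] [TopologicalSpace T] [DiscreteTopology T]
variable (ρ : ContinuousRep G ℤ T)

/-- **Corestrictions from `S'` are corestrictions from `S₁`** (`T` trivial with `2T = 0`; `S'` closed of finite index
with `H³(S', T) = 0`; `S₁` closed of index `2`): `cor_{S'}(H²(S', T)) ⊆ cor_{S₁}(H²(S₁, T))`.  Since `S₁` is normal,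
`[S' : S' ∩ S₁]` divides `2`; if it is `1` then `S' ≤ S₁` and transitivity suffices; if it is `2`, the Gysin
sequence of the index-`2` open subgroup `S' ∩ S₁` of the profinite group `S'` in degree `2`
(`mem_range_cor_two_of_subsingleton_three`: `cor : H²(S' ∩ S₁, T) → H²(S', T)` is onto as `H³(S', T) = 0`) and
transitivity twice (`S' ∩ S₁ ≤ S'`, `S' ∩ S₁ ≤ S₁`).
[cite: SerreGaloisCohomology1997, I §2.5] [cite: NeukirchSchmidtWingberg2008, I §5 Prop. 1.5.3 (iii)] -/
theorem range_cor_two_subset_of_index_two (htriv : ∀ (x : G) (t : T), ρ x t = t) (h2 : ∀ t : T, 2 • t = 0)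
    (S' S₁ : Subgroup G) [hS' : IsClosed (S' : Set G)] [hS₁ : IsClosed (S₁ : Set G)]
    [Fintype (G ⧸ S')] [Fintype (G ⧸ S₁)] (hidx : S₁.index = 2)
    [Subsingleton (continuousCohomology 3 (ρ.restrict (subgroupIncl S')).toTopRep)] :
    Set.range (cor S' ρ 2) ⊆ Set.range (cor S₁ ρ 2) := by
  classical
  haveI : S₁.Normal := Subgroup.normal_of_index_eq_two hidx
  have hdvd : S₁.relIndex S' ∣ 2 := hidx ▸ Subgroup.relIndex_dvd_index_of_normal (H := S₁) (K := S')
  rcases (Nat.dvd_prime Nat.prime_two).1 hdvd with h1 | hrel2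
  · -- `S' ≤ S₁`
    exact range_cor_subset_range_cor_of_le ρ (Subgroup.relIndex_eq_one.1 h1) 2
  · -- `[S' : S' ∩ S₁] = 2`
    set S'' : Subgroup G := S' ⊓ S₁ with hS''def
    haveI hS''c : IsClosed ((S'' : Subgroup G) : Set G) := hS'.inter hS₁
    have hS''i : S''.index ≠ 0 :=
      Subgroup.index_inf_ne_zero Subgroup.index_ne_zero_of_finite Subgroup.index_ne_zero_of_finite
    haveI : Fintype (G ⧸ S'') := Subgroup.fintypeOfIndexNeZero hS''i
    have hidx2 : (S''.subgroupOf S').index = 2 := by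
      change S''.relIndex S' = 2
      rw [hS''def, Subgroup.inf_relIndex_left]
      exact hrel2
    haveI : Fintype (S' ⧸ S''.subgroupOf S') := Subgroup.fintypeOfIndexNeZero (by rw [hidx2]; norm_num)
    haveI : CompactSpace S' := compactSpace_of_isClosed_subgroup
    haveI : IsClosed ((S''.subgroupOf S' : Subgroup S') : Set S') := isClosed_subgroupOf_of_isClosed S' S''
    -- `S''` is open in `G` (closed of finite index), hence `S''.subgroupOf S'` is open in `S'`
    haveI : S''.FiniteIndex := ⟨hS''i⟩
    have hS''o : IsOpen ((S'' : Subgroup G) : Set G) := Subgroup.isOpen_of_isClosed_of_finiteIndex S'' hS''c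
    have hHo : IsOpen ((S''.subgroupOf S' : Subgroup S') : Set S') := hS''o.preimage continuous_subtype_val
    have htriv' : ∀ (x : S') (t : T), (ρ.restrict (subgroupIncl S')) x t = t := fun x t => htriv x t
    have hSES := isSES_unitCoind_normCoind (S := S''.subgroupOf S') (ρ.restrict (subgroupIncl S')) htriv' h2 hHo hidx2
    rintro _ ⟨x, rfl⟩
    obtain ⟨z, hz⟩ := mem_range_cor_two_of_subsingleton_three (ρ.restrict (subgroupIncl S')) hSES x
    rw [← hz, cor_cor_subgroupOf S' S'' ρ inf_le_left 2 z]
    exact range_cor_subset_range_cor_of_le ρ (inf_le_right : S'' ≤ S₁) 2 ⟨_, rfl⟩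

end IndexTwoTransfer

/-! ## §3 Number fields: `cor(H²(Γ_{F(√a)}, T)) ⊆ cor(H²(Γ_{F(√-1)}, T))` for `a` totally negative -/

section NumberField

variable {F : Type} [Field F] [NumberField F]
variable {T : Type} [AddCommGroup T] [TopologicalSpace T] [DiscreteTopology T]
variable (σT : DiscreteGaloisModule F T)

/-- **Brick B7 of the `hbase` road**: for a number field `F`, a trivial `Γ_F`-module `T` with `2T = 0`, `a ∈ F` negative
under every real embedding with `α² = a`, `α ∉ F`, and `I² = -1`, `I ∉ F`: every class of `H²(Γ_F, T)` that is a
corestriction from `Γ_{F(α)}` is a corestriction from `Γ_{F(I)}` (`cd₂(Γ_{F(α)}) ≤ 2` since `F(α)` is totally complex —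
`groupCdLE_two_galFixing_adjoin`; `[Γ_F : Γ_{F(I)}] = 2` — `index_galFixing_adjoin_eq_two`; then §2).
[cite: SerreGaloisCohomology1997, II §4.4 Prop. 13] [cite: MilneADT2006, Ch. I, Thm. 4.10 (c)] -/
theorem range_cor_galFixing_adjoin_subset_of_neg (htriv : ∀ (x : absoluteGaloisGroup F) (t : T), σT x t = t)
    (h2 : ∀ t : T, 2 • t = 0)
    (a : F) (α : AlgebraicClosure F) (hα : α * α = algebraMap F _ a) (hneg : ∀ φ : F →+* ℝ, φ a < 0)
    (hαF : α ∉ (algebraMap F (AlgebraicClosure F)).range)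
    (I : AlgebraicClosure F) (hI : I * I = -1) (hIF : I ∉ (algebraMap F (AlgebraicClosure F)).range)
    [Fintype (absoluteGaloisGroup F ⧸ galFixing F (IntermediateField.adjoin F {α}))]
    [IsClosed (galFixing F (IntermediateField.adjoin F {α}) : Set (absoluteGaloisGroup F))]
    [Fintype (absoluteGaloisGroup F ⧸ galFixing F (IntermediateField.adjoin F {I}))]
    [IsClosed (galFixing F (IntermediateField.adjoin F {I}) : Set (absoluteGaloisGroup F))] :
    Set.range (cor (galFixing F (IntermediateField.adjoin F {α})) σT 2) ⊆
      Set.range (cor (galFixing F (IntermediateField.adjoin F {I})) σT 2) := by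
  have hIa : I * I = algebraMap F _ (-1) := by rw [map_neg, map_one]; exact hI
  have hidx : (galFixing F (IntermediateField.adjoin F {I})).index = 2 := index_galFixing_adjoin_eq_two (-1) I hIa hIF
  have hprim : IsPrimaryTorsion 2 T := fun t => ⟨1, by rw [pow_one]; exact h2 t⟩
  haveI : Subsingleton (continuousCohomology 3
      (σT.restrict (subgroupIncl (galFixing F (IntermediateField.adjoin F {α})))).toTopRep) :=
    groupCdLE_two_galFixing_adjoin a α hα hneg hαF T _ hprim (show 2 < 3 by norm_num)
  exact range_cor_two_subset_of_index_two σT htriv h2 _ _ hidx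

/-- **Brick B7, pointwise form** (the shape consumed by `realThree_injective_of_norm_imaginary`): under the hypotheses of
`range_cor_galFixing_adjoin_subset_of_neg`, a class `y ∈ cor(H²(Γ_{F(α)}, T))` lies in `cor(H²(Γ_{F(I)}, T))`.
[cite: SerreGaloisCohomology1997, II §4.4 Prop. 13] [cite: MilneADT2006, Ch. I, Thm. 4.10 (c)] -/
theorem mem_range_cor_galFixing_sqrt_neg_one (htriv : ∀ (x : absoluteGaloisGroup F) (t : T), σT x t = t)
    (h2 : ∀ t : T, 2 • t = 0)
    (a : F) (α : AlgebraicClosure F) (hα : α * α = algebraMap F _ a) (hneg : ∀ φ : F →+* ℝ, φ a < 0)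
    (hαF : α ∉ (algebraMap F (AlgebraicClosure F)).range)
    (I : AlgebraicClosure F) (hI : I * I = -1) (hIF : I ∉ (algebraMap F (AlgebraicClosure F)).range)
    [Fintype (absoluteGaloisGroup F ⧸ galFixing F (IntermediateField.adjoin F {α}))]
    [IsClosed (galFixing F (IntermediateField.adjoin F {α}) : Set (absoluteGaloisGroup F))]
    [Fintype (absoluteGaloisGroup F ⧸ galFixing F (IntermediateField.adjoin F {I}))]
    [IsClosed (galFixing F (IntermediateField.adjoin F {I}) : Set (absoluteGaloisGroup F))]
    (y : galoisCohomology σT 2) (hy : y ∈ Set.range (cor (galFixing F (IntermediateField.adjoin F {α})) σT 2)) :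
    y ∈ Set.range (cor (galFixing F (IntermediateField.adjoin F {I})) σT 2) :=
  range_cor_galFixing_adjoin_subset_of_neg σT htriv h2 a α hα hneg hαF I hI hIF hy

end NumberField

end Summit.BirchSwinnertonDyer.BirchSwinnertonDyer.Theorems.SignedEC.ShaThreeBase

end
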